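import Summits.BirchSwinnertonDyer.Rank1Residual.O5.HeegnerLogTransportThreeCitedEnd
import Literature.NumberTheory.EllipticCurves.KrausOesterle1992.TraceCongruenceOfTorsionIsoProofs
import Literature.NumberTheory.EllipticCurves.NonEisensteinPrimeOfSurjective
import Literature.NumberTheory.EllipticCurves.Fisher2012.HesseFamilyThreeCongruenceProofs
import Literature.NumberTheory.EllipticCurves.Fisher2012.HesseFamilyThreeReverseProofs
import Summits.BirchSwinnertonDyer.Rank1Residual.X1.CongruenceTransfer
import HarnessLib
import HarnessLib.Audit.Tags

/-!
# O5 (t′) Heegner-log transport at `p = 3` — part 20: the companion relation in ISO / X3E / KO currency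

HONEST FRAMING (cell `b2b-bsdres`, home `run/shared/lean/b2b/bsd-rank1-residual/`; seat o5-r2 =
O5 planner 2, NON-Iwasawa side): O5 = tame additive potentially supersingular reduction at `p = 3`
(twist view (t′)) is OPEN as a class; this line is a RESEARCH ROUTE whose per-curve ENDs are
CONDITIONAL theorems (named literature facts as labelled hypotheses) consumed row by row by the
census, which is EVIDENCE and never a Literature fact; nothing here is booked, no mark / label /
count / tier of the RESIDUAL-MAP moves. THEOREMS ONLY: 0 `def`, 0 new named fact, no `sorry`; every
ingredient is already in the tree and is used BY NAME.

WHAT. Part 15's END of record `o5_index_unit_of_ordinary_companion_cited`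
(`O5/HeegnerLogTransportThreeCitedEnd.lean`) carries exactly ONE per-pair binder that is not a finite
computation: `hcong : IsCongruentModThree W G` — `a_ℓ(W) ≡ a_ℓ(G) (mod 3)` at EVERY prime
`ℓ ∤ 3·N_W·N_G` (the census's CONG-v1 links are only SCREENED at `ℓ ≤ 97`). This file changes the
CURRENCY of that binder, three ways, with no new fact:

* §1 `isCongruentModThree_of_torsionIso : TorsionIso G W 3 → IsCongruentModThree W G` — the cell's
  `3`-congruence currency (`X1.CongruenceTransfer.TorsionIso`: `∃ e : G[3] ≃+ W[3]` `Γ_ℚ`-equivariant)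
  gives the congruence: Kraus–Oesterlé 1992 Prop. 3 (i) ⇒ (iii) at the good primes, PROVED in the tree
  as `KrausOesterle1992.lFunction_congr_of_addEquiv_geomTorsion` (n1011-lit, p354819; the converse for
  surjective `ρ̄₃` is `CompanionTypeLawThree.exists_addEquiv_geomTorsion_of_isCongruentModThree`);
  `isCongruentModThree_of_hesseCertificate` / `…_of_dualHesseCertificate`: ONE ROW `(l, m, u)` of an
  X3E table (a rational point of `X_W(3)` resp. `X_W^-(3)`: two polynomial identities in `ℚ`, closed by
  `norm_num` against `Fisher2012.eval_hesseC4three / eval_hesseC6three / eval_hesseD3`) gives the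
  congruence UNCONDITIONALLY, because Fisher 2012 Thm. 13.2 (`n = 3`) and its `X_E^-(3)` analogue are
  PROVED in the tree (`Fisher2012.threeCongruent_of_hesseCertificate_unconditional`,
  `…_of_dualHesseCertificate_unconditional`; kernel template `O5/X3ECertificates.lean`); and
  `isCongruentModThree_of_prop4`: Kraus–Oesterlé's Prop. 4 FINITE trace list (primes `ℓ` with
  `6ℓ < ψ(M)`) gives it CONDITIONALLY on the registered fact A30
  `KrausOesterle1992.prop4_torsionIso_of_congruences` (`…lFunction_congr_of_prop4`; irreducibility of
  `ρ̄_{W,3}` from the END's `hρ` by `hasIrreducibleModPGaloisRep_of_hasSurjectiveModNGaloisRep`).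
* §2 ENDs = part 15's END with `hcong` REPLACED and every other binder verbatim:
  `o5_index_unit_of_ordinary_companion_cited_iso` (`hT : TorsionIso G W 3`), `…_cited_x3e` /
  `…_cited_x3eRev` (the decidable row data `(l m u : ℚ) (hu : u ≠ 0) (h4 …) (h6 …)` of a direct /
  reverse certificate — the companion relation then costs two `norm_num` goals and NO fact), and
  `…_cited_ko` (`hKO` = A30 + the finite list `hlist`).

CENSUS SIDE (EVIDENCE, o5-r2 GEN 24, `b2b-bsdres-o5-r2/gen24/census/KL3-X3E-certs-o5r2-g24.tsv`):
the cell's registered X3E engine (cc-eng-2 `translinks` v0.4 `x3e.py`, selftest PASS) run on the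
o5-r2 GEN 16 KL3 census pairs certifies 870 / 870 pairs EXACTLY (561 direct + 309 reverse; complete
root search; 274 / 274 pairs with a good-ORDINARY companion, 183 distinct `W`), each identity
re-verified in exactly the shape of `h4` / `h6` below; two rows are carried into the kernel in the
sibling leaf `O5/HeegnerLogTransportThreeIsoCurrencyRows.lean` (part 20b).

Placement note for the O5 typer (cc-typer-5): new leaf, imports only placed modules; namespace
`…O5.HeegnerLogTransport` as parts 1–19; standalone farm check rc 0 / 0 warnings / 0 sorries;
`#print axioms` of `…_cited_x3eRev` and `…_cited_ko` = {propext, Classical.choice, Quot.sound}.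

## TYPER PLACEMENT NOTE (cc-typer-5 GEN 20 = O5 §3.5 / O6 §3.4 typer of record; by-name ask A-O5-G24-1 of o5-r2 GEN 24, HOME/INBOX.md l.14533 (1):
'place PART 20 → PART 20b → PART 21 as new leaves (no node touched)'; order of record 20 → 20b → 21; memo `HOME/b2b-bsdres-o5-r2/gen24/O5-GEN24.md` cd5acd5f2d83ffec)

Source: `HOME/b2b-bsdres-o5-r2/gen24/lean/HeegnerLogTransportThreeIsoCurrency.lean` sha16 `667bfd5750e541de` (368 l.; `gen24/SHA16.txt`; o5-r2's checks: standalone farm `lean_check`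
rc 0 / 0 err / 0 warn / 0 sorry, `#print axioms …_cited_x3e`, `…_cited_x3eRev`, `…_cited_ko` = {propext, Classical.choice, Quot.sound}; merged scratch with part 20b
`gen24/lean/scratch/scratch_part20_20b_merged.lean` 74a9aa56eb758a9b rc 0), re-hashed by the typer right before writing; THIS file = KL3 part 20 = the source
VERBATIM + this paragraph (imports, module text, every declaration block byte-identical; script `class-closure/typer-5/gen20/g24_place.py`); placed AFTER part 15
`O5/HeegnerLogTransportThreeCitedEnd.lean` (p353868, this seat) and `Literature/NumberTheory/EllipticCurves/KrausOesterle1992/TraceCongruenceOfTorsionIsoProofs.lean`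
(p354819, n1011-lit GEN 36), both in the tree; the typer's own standalone farm check (rc 0 / 0 warnings, axioms std) and DEDUP (`lean search --decl` on the 8 new
names: no match) precede the proposal.
CONTENT LABELS (source, unchanged): THEOREMS ONLY — 0 `def`, 0 `@[conjecture]`, 0 Literature facts (net named-fact debt 0), no `sorry`; published inputs stay displayed
hypotheses BY NAME (Kriz–Li Thm. 1.16 as the registered Literature fact A314 `KrizLi2019.thm116_padicLogHeegner_congruence`; Kraus–Oesterlé Prop. 4 as the registered
fact A30 `KrausOesterle1992.prop4_torsionIso_of_congruences` in the `_ko` variant ONLY; Yan–Zhu, Kolyvagin, Gross–Zagier(–Kolyvagin), modularity `exists_isNewformOf`, …);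
tree theorems reused BY NAME (`KrausOesterle1992.lFunction_congr_of_addEquiv_geomTorsion` / `…lFunction_congr_of_prop4`, `Fisher2012.threeCongruent_of_hesseCertificate_unconditional`
/ `…_of_dualHesseCertificate_unconditional`, `hasIrreducibleModPGaloisRep_of_hasSurjectiveModNGaloisRep`, part 15's END `o5_index_unit_of_ordinary_companion_cited`),
nothing re-proved; ENDs of record after this file: `o5_index_unit_of_ordinary_companion_cited_iso / _cited_x3e / _cited_x3eRev / _cited_ko` (§2).
KL3 parts in the tree: 1–3 p340741 / p341262 / p341640 (part 1 doc restamp p353140), Global p342632, OrdCompanion p343587 + p344465, OrdSelmer p345030 + p345686,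
OrdTwist p346273, Residual Engine p347366 + Residual p348865 + End p350277, BaseSelmer p349318, ExactCount p349954, GoodSelmer p350559, TameTamagawa p350983,
RatLogUnit p351404, ResidualEndFacts p352109, BaseSelmerCount p352220, KrizLiGlue p352538, StepZero p352755, ShaDescent p352972, CitedEnd p353868, StepZeroEnd
p354679 + StepZeroEndRecord p355323; E116′ `O5/HeegnerTwistTamagawaThree.lean` p354556 (harvest-2); Literature: index lemma p344022,
A314 p350088, Kraus–Oesterlé Prop. 3 (i)⇒(iii) proofs p354819 (n1011-lit).  HONEST FRAMING (cell `b2b-bsdres`): research route, lane CLASS-CLOSURE §3.5 O5;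
CONDITIONAL theorems — nothing asserted beyond the displayed binders, nothing booked, no mark of `RESIDUAL-MAP.md` moves; census = EVIDENCE, never a
Literature fact; O5 OPEN.
-/

noncomputable section

open scoped Classical NumberField

open IsDedekindDomain Field WeierstrassCurve Literature.NumberTheory.EllipticCurves
  Literature.NumberTheory.EllipticCurves.ModularForms
  Literature.NumberTheory.EllipticCurves.Rank1Residual
  Literature.NumberTheory.EllipticCurves.Rank1Residual.Typed
  Literature.NumberTheory.GaloisRepresentations Rat.HeightOneSpectrum
open Literature.NumberTheory.EllipticCurves.Fisher2012 (hesseC4three hesseC6three hesseD3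
  eval_hesseC4three eval_hesseC6three eval_hesseD3
  threeCongruent_of_hesseCertificate_unconditional threeCongruent_of_dualHesseCertificate_unconditional)
open Summit.BirchSwinnertonDyer.Rank1Residual.X1.CongruenceTransfer (TorsionIso)
open Summit.BirchSwinnertonDyer.Rank1Residual.X11b (embAt)
open Literature.NumberTheory.GaloisCohomology (poitouTate_selmerStructure_duality)

set_option autoImplicit false

namespace Summit.BirchSwinnertonDyer.Rank1Residual.O5.HeegnerLogTransport

section IsoToCongruence

variable (W G : WeierstrassCurve ℚ) [W.IsElliptic] [W.IsGloballyMinimal] [G.IsElliptic]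
  [G.IsGloballyMinimal]

/-- **The cell's `3`-congruence currency gives the census congruence**: `TorsionIso G W 3`
(`X1.CongruenceTransfer`: `∃ e : G[3] ≃+ W[3]` `Γ_ℚ`-equivariant — the conclusion of every X3E Hesse
certificate `Fisher2012.threeCongruent_of_hesseCertificate_unconditional` /
`…_of_dualHesseCertificate_unconditional`, of `O5/X3ECertificates`, and the second clause of the O6
currency `Additive.IsCompanionThree W G`) implies `IsCongruentModThree W G` — Kraus–Oesterlé 1992
Prop. 3 (i) ⇒ (iii) at the good primes, PROVED in the tree
(`KrausOesterle1992.lFunction_congr_of_addEquiv_geomTorsion`, n1011-lit, p354819).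
[cite: KrausOesterle1992, Prop. 3 (i) ⇒ (iii) (pp. 262–263)] -/
theorem isCongruentModThree_of_torsionIso (hT : TorsionIso G W 3) : IsCongruentModThree W G := by
  obtain ⟨e, he⟩ := hT.symm
  intro ℓ hℓ hndvd
  exact KrausOesterle1992.lFunction_congr_of_addEquiv_geomTorsion W G 3 e he hℓ hndvd

/-- **An X3E row of DIRECT kind gives the census congruence, unconditionally**: `l m u : ℚ`, `u ≠ 0`,
`𝔠₄(l,m) = u⁴·c₄(G)`, `𝔠₆(l,m) = u⁶·c₆(G)` (the `n = 3` Hesse polynomials of `W`; two `norm_num`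
identities per table row) ⟹ `IsCongruentModThree W G` — Fisher 2012 Thm. 13.2 (`n = 3`) is PROVED in
the tree (`Fisher2012.thm132_threeCongruent_hessePencil_holds`). [cite: Fisher2012Hessian, Thm. 13.2 (n = 3)] -/
theorem isCongruentModThree_of_hesseCertificate (l m u : ℚ) (hu : u ≠ 0)
    (h4 : MvPolynomial.eval ![l, m] (hesseC4three W.c₄ W.c₆) = u ^ 4 * G.c₄)
    (h6 : MvPolynomial.eval ![l, m] (hesseC6three W.c₄ W.c₆) = u ^ 6 * G.c₆) :
    IsCongruentModThree W G :=
  isCongruentModThree_of_torsionIso W G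
    (threeCongruent_of_hesseCertificate_unconditional W G l m u hu h4 h6)

/-- **An X3E row of REVERSE kind gives the census congruence, unconditionally** (dual Hesse pencil,
`Δ′ = c₄(W)³ − c₆(W)²`: `−𝔇(l,m)/(4Δ′) = u⁴·c₄(G)`, `−𝔠₆(l,m)/(8Δ′²) = u⁶·c₆(G)`) — the
anti-symplectic `3`-congruences (`Fisher2012.thm132rev_threeCongruent_dualHessePencil_holds`).
[cite: Fisher2012Hessian, §13 (analogue of Thm. 13.2 for X_E^-(3))] -/
theorem isCongruentModThree_of_dualHesseCertificate (l m u : ℚ) (hu : u ≠ 0)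
    (h4 : -MvPolynomial.eval ![l, m] (hesseD3 W.c₄ W.c₆) / (4 * (W.c₄ ^ 3 - W.c₆ ^ 2)) = u ^ 4 * G.c₄)
    (h6 : -MvPolynomial.eval ![l, m] (hesseC6three W.c₄ W.c₆) / (8 * (W.c₄ ^ 3 - W.c₆ ^ 2) ^ 2) =
      u ^ 6 * G.c₆) :
    IsCongruentModThree W G :=
  isCongruentModThree_of_torsionIso W G
    (threeCongruent_of_dualHesseCertificate_unconditional W G l m u hu h4 h6)

/-- **Kraus–Oesterlé currency (path (A) of o5-r2 GEN 23, A-O5-G23-2)**: for `W` with surjective — hence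
irreducible (`hasIrreducibleModPGaloisRep_of_hasSurjectiveModNGaloisRep`) — `ρ̄_{W,3}`, the FINITE list
of trace congruences of Kraus–Oesterlé's Proposition 4 (primes `ℓ` with `6ℓ < ψ(M)`,
`M = lcm(N_W, N_G)·∏_{ℓ ∈ S} ℓ`: `a_ℓ(W) ≡ a_ℓ(G)` at `ℓ ∤ N_W N_G`, `a_ℓ a_ℓ′ ≡ ℓ + 1` at `ℓ ∥ N_W N_G`)
gives `IsCongruentModThree W G`, CONDITIONAL on the registered fact A30
`KrausOesterle1992.prop4_torsionIso_of_congruences` (composition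
`KrausOesterle1992.lFunction_congr_of_prop4`, n1011-lit, p354819). [cite: KrausOesterle1992, Prop. 4 (pp. 263–264)] -/
theorem isCongruentModThree_of_prop4 (hKO : KrausOesterle1992.prop4_torsionIso_of_congruences)
    (hρ : W.HasSurjectiveModNGaloisRep 3)
    (hlist : ∀ (ℓ : ℕ) [Fact ℓ.Prime],
      6 * ℓ < KrausOesterle1992.gammaZeroIndex (KrausOesterle1992.modulus W G) →
        (padicValNat ℓ (W.conductorNorm ℤ * G.conductorNorm ℤ) = 0 →
            (3 : ℤ) ∣ W.frobeniusTrace ℓ - G.frobeniusTrace ℓ) ∧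
          (padicValNat ℓ (W.conductorNorm ℤ * G.conductorNorm ℤ) = 1 →
            (3 : ℤ) ∣ W.frobeniusTrace ℓ * G.frobeniusTrace ℓ - (ℓ + 1))) :
    IsCongruentModThree W G :=
  KrausOesterle1992.lFunction_congr_of_prop4 hKO W G 3
    (hasIrreducibleModPGaloisRep_of_hasSurjectiveModNGaloisRep W 3 hρ) hlist

end IsoToCongruence

section End

/-- **O5 (t′) END of record, cited form, ISO CURRENCY.** Part 15's END
`o5_index_unit_of_ordinary_companion_cited` with its one non-finitary per-pair binder `hcong`
(`a_ℓ(W) ≡ a_ℓ(G) (mod 3)` at EVERY `ℓ ∤ 3 N_W N_G` — certifiable only through a Sturm-bound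
argument the tree does not have) REPLACED by the cell's `3`-congruence currency `hT : TorsionIso G W 3` (`∃ e : G[3] ≃+ W[3]`
`Γ_ℚ`-equivariant — what every X3E Hesse certificate concludes, and the second clause of the O6
currency `Additive.IsCompanionThree W G`), via `isCongruentModThree_of_torsionIso`. Everything else
verbatim.
[cite: KrizLi2019, Thm. 1.16, Rem. 1.17 (FMS 7 (2019) e15)] [cite: DarmonDiamondTaylor1995, Prop. 2.11 (a) (PDF p. 57)] -/
theorem o5_index_unit_of_ordinary_companion_cited_iso
    (hKL : KrizLi2019.thm116_padicLogHeegner_congruence)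
    (hPT : ∀ (K : Type) [Field K] [NumberField K], poitouTate_selmerStructure_duality K)
    (hEP : ∀ (K : Type) [Field K] [NumberField K] (v : HeightOneSpectrum (𝓞 K)),
      localEulerPoincareCharacteristic (v.adicCompletion K))
    (hYZ : YanZhu2026.thm415_padicValRat_bsd_rank_le_one)
    (hW20 : Wuthrich2014.lemma20_surjective_threeAdic_of_semistable)
    (hmod : exists_isNewformOf) (hGZK : rank_eq_analyticRank_of_analyticRank_le_one)
    (W G : WeierstrassCurve ℚ) [W.IsElliptic] [W.IsGloballyMinimal] [G.IsElliptic] [G.IsGloballyMinimal]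
    (hT : TorsionIso G W 3)
    (hρ : W.HasSurjectiveModNGaloisRep 3) (hadd : Addv W 3) (ht3 : NoLocalThreeTorsionAt W 3)
    (htℓ : ∀ (ℓ : ℕ) [Fact ℓ.Prime], ℓ ≠ 3 → (ℓ : ℤ) ∣ W.conductorNorm ℤ * G.conductorNorm ℤ →
      NoLocalThreeTorsionAt W ℓ)
    (hunitW : ∀ ℓ ∈ klSet W G, ℓ ≠ 3 → padicValInt 3 (nsCount W ℓ) = 0)
    (hunitG : ∀ ℓ ∈ klSet G W, ℓ ≠ 3 → padicValInt 3 (nsCount G ℓ) = 0)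
    (htam : ¬ 3 ∣ W.tamagawaProduct) (htamG : ¬ 3 ∣ G.tamagawaProduct) (hordG : GoodOrd G 3)
    (Gd : WeierstrassCurve ℚ) [Gd.IsElliptic] [Gd.IsGloballyMinimal]
    {N N' : ℕ} [NeZero N] [NeZero N'] (D : ModularParametrizationData W N)
    (D' : ModularParametrizationData G N')
    (K : Type) [Field K] [NumberField K] (hK : IsImaginaryQuadratic K)
    (hH : SatisfiesHeegnerHypothesis N K) (hH' : SatisfiesHeegnerHypothesis N' K)
    (hKoW : kolyvagin N W K) (hKoG : kolyvagin N' G K) (hGZG : gross_zagier N' G K)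
    (hd : NumberField.discr K < -4) (h3d : ¬ ((3 : ℤ) ∣ NumberField.discr K))
    (hGd : ∃ C : VariableChange ℚ, C • G.quadraticTwist (NumberField.discr K : ℚ) = Gd)
    (H : HeegnerDatum N (NumberField.discr K)) (H' : HeegnerDatum N' (NumberField.discr K))
    (ι : K →+* ℂ) (𝔭 : HeightOneSpectrum (𝓞 K)) (h𝔭 : ((3 : ℕ) : 𝓞 K) ∈ 𝔭.asIdeal)
    (he : 𝔭.asIdeal.ramificationIdx (𝓞 ℚ) = 1) (hf : 𝔭.asIdeal.inertiaDeg (𝓞 ℚ) = 1)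
    (P : (W.baseChange K).toAffine.Point) (P' : (G.baseChange K).toAffine.Point)
    (hP : WeierstrassCurve.Affine.Point.map ι.toRatAlgHom P = heegnerPointComplex D H)
    (hP' : WeierstrassCurve.Affine.Point.map ι.toRatAlgHom P' = heegnerPointComplex D' H')
    (hPinf : ¬ IsOfFinAddOrder P) (hP'inf : ¬ IsOfFinAddOrder P')
    (hshaW : Nat.card (AddCommGroup.primaryComponent (W.baseChange K).sha 3) = 1)
    (hQW : ∃ Q : (W.baseChange K).toAffine.Point, ¬ IsOfFinAddOrder Q ∧
      X11b.padicLogOrd W 3 (embAt K 3 𝔭 h𝔭 he hf) Q = 0)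
    (hcD : padicValInt 3 D.maninConstant = 0) (hcD' : padicValInt 3 D'.maninConstant = 0)
    {q₀ q₁ : ℚ} (hq₀ : shaAn G = (q₀ : ℂ)) (hq₁ : shaAn Gd = (q₁ : ℂ))
    (hstep0 : padicValRat 3 q₀ + padicValRat 3 q₁ + ((2 * padicValNat 3 G.tamagawaProduct : ℕ) : ℤ) +
        ((2 * padicValInt 3 D'.maninConstant : ℕ) : ℤ) =
      ((2 * padicValNat 3 (AddSubgroup.zmultiples P').index : ℕ) : ℤ)) :
    padicValNat 3 (AddSubgroup.zmultiples P).index = 0 :=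
  o5_index_unit_of_ordinary_companion_cited hKL hPT hEP hYZ hW20 hmod hGZK W G
    (isCongruentModThree_of_torsionIso W G hT) hρ hadd ht3 htℓ hunitW hunitG htam
    htamG hordG Gd D D' K hK hH hH' hKoW hKoG hGZG hd h3d hGd H H' ι 𝔭 h𝔭 he hf P P' hP hP' hPinf
    hP'inf hshaW hQW hcD hcD' hq₀ hq₁ hstep0

/-- **O5 (t′) END, cited form, X3E-CERTIFICATE CURRENCY (direct kind).** As `…_cited_iso` with the
companion relation supplied by ONE ROW of the cell's X3E table (`translinks` X3E; columns `W, G, kind,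
l, m, u`): per-pair DECIDABLE data `l m u : ℚ`, `u ≠ 0` and the two polynomial identities
`𝔠₄(l,m) = u⁴·c₄(G)`, `𝔠₆(l,m) = u⁶·c₆(G)` (`norm_num` against `Fisher2012.eval_hesseC4three /
eval_hesseC6three`), consumed by the tree's UNCONDITIONAL `Fisher2012.threeCongruent_of_hesseCertificate_unconditional`
— no named fact enters for the companion relation. [cite: KrizLi2019, Thm. 1.16, Rem. 1.17 (FMS 7 (2019) e15)]
[cite: Fisher2012Hessian, Thm. 13.2 (n = 3)] -/
theorem o5_index_unit_of_ordinary_companion_cited_x3e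
    (hKL : KrizLi2019.thm116_padicLogHeegner_congruence)
    (hPT : ∀ (K : Type) [Field K] [NumberField K], poitouTate_selmerStructure_duality K)
    (hEP : ∀ (K : Type) [Field K] [NumberField K] (v : HeightOneSpectrum (𝓞 K)),
      localEulerPoincareCharacteristic (v.adicCompletion K))
    (hYZ : YanZhu2026.thm415_padicValRat_bsd_rank_le_one)
    (hW20 : Wuthrich2014.lemma20_surjective_threeAdic_of_semistable)
    (hmod : exists_isNewformOf) (hGZK : rank_eq_analyticRank_of_analyticRank_le_one)
    (W G : WeierstrassCurve ℚ) [W.IsElliptic] [W.IsGloballyMinimal] [G.IsElliptic] [G.IsGloballyMinimal]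
    (l m u : ℚ) (hu : u ≠ 0)
    (h4 : MvPolynomial.eval ![l, m] (hesseC4three W.c₄ W.c₆) = u ^ 4 * G.c₄)
    (h6 : MvPolynomial.eval ![l, m] (hesseC6three W.c₄ W.c₆) = u ^ 6 * G.c₆)
    (hρ : W.HasSurjectiveModNGaloisRep 3) (hadd : Addv W 3) (ht3 : NoLocalThreeTorsionAt W 3)
    (htℓ : ∀ (ℓ : ℕ) [Fact ℓ.Prime], ℓ ≠ 3 → (ℓ : ℤ) ∣ W.conductorNorm ℤ * G.conductorNorm ℤ →
      NoLocalThreeTorsionAt W ℓ)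
    (hunitW : ∀ ℓ ∈ klSet W G, ℓ ≠ 3 → padicValInt 3 (nsCount W ℓ) = 0)
    (hunitG : ∀ ℓ ∈ klSet G W, ℓ ≠ 3 → padicValInt 3 (nsCount G ℓ) = 0)
    (htam : ¬ 3 ∣ W.tamagawaProduct) (htamG : ¬ 3 ∣ G.tamagawaProduct) (hordG : GoodOrd G 3)
    (Gd : WeierstrassCurve ℚ) [Gd.IsElliptic] [Gd.IsGloballyMinimal]
    {N N' : ℕ} [NeZero N] [NeZero N'] (D : ModularParametrizationData W N)
    (D' : ModularParametrizationData G N')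
    (K : Type) [Field K] [NumberField K] (hK : IsImaginaryQuadratic K)
    (hH : SatisfiesHeegnerHypothesis N K) (hH' : SatisfiesHeegnerHypothesis N' K)
    (hKoW : kolyvagin N W K) (hKoG : kolyvagin N' G K) (hGZG : gross_zagier N' G K)
    (hd : NumberField.discr K < -4) (h3d : ¬ ((3 : ℤ) ∣ NumberField.discr K))
    (hGd : ∃ C : VariableChange ℚ, C • G.quadraticTwist (NumberField.discr K : ℚ) = Gd)
    (H : HeegnerDatum N (NumberField.discr K)) (H' : HeegnerDatum N' (NumberField.discr K))
    (ι : K →+* ℂ) (𝔭 : HeightOneSpectrum (𝓞 K)) (h𝔭 : ((3 : ℕ) : 𝓞 K) ∈ 𝔭.asIdeal)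
    (he : 𝔭.asIdeal.ramificationIdx (𝓞 ℚ) = 1) (hf : 𝔭.asIdeal.inertiaDeg (𝓞 ℚ) = 1)
    (P : (W.baseChange K).toAffine.Point) (P' : (G.baseChange K).toAffine.Point)
    (hP : WeierstrassCurve.Affine.Point.map ι.toRatAlgHom P = heegnerPointComplex D H)
    (hP' : WeierstrassCurve.Affine.Point.map ι.toRatAlgHom P' = heegnerPointComplex D' H')
    (hPinf : ¬ IsOfFinAddOrder P) (hP'inf : ¬ IsOfFinAddOrder P')
    (hshaW : Nat.card (AddCommGroup.primaryComponent (W.baseChange K).sha 3) = 1)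
    (hQW : ∃ Q : (W.baseChange K).toAffine.Point, ¬ IsOfFinAddOrder Q ∧
      X11b.padicLogOrd W 3 (embAt K 3 𝔭 h𝔭 he hf) Q = 0)
    (hcD : padicValInt 3 D.maninConstant = 0) (hcD' : padicValInt 3 D'.maninConstant = 0)
    {q₀ q₁ : ℚ} (hq₀ : shaAn G = (q₀ : ℂ)) (hq₁ : shaAn Gd = (q₁ : ℂ))
    (hstep0 : padicValRat 3 q₀ + padicValRat 3 q₁ + ((2 * padicValNat 3 G.tamagawaProduct : ℕ) : ℤ) +
        ((2 * padicValInt 3 D'.maninConstant : ℕ) : ℤ) =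
      ((2 * padicValNat 3 (AddSubgroup.zmultiples P').index : ℕ) : ℤ)) :
    padicValNat 3 (AddSubgroup.zmultiples P).index = 0 :=
  o5_index_unit_of_ordinary_companion_cited_iso hKL hPT hEP hYZ hW20 hmod hGZK W G
    (threeCongruent_of_hesseCertificate_unconditional W G l m u hu h4 h6) hρ hadd ht3 htℓ hunitW hunitG
    htam htamG hordG Gd D D' K hK hH hH' hKoW hKoG hGZG hd h3d hGd H H' ι 𝔭 h𝔭 he hf P P' hP hP' hPinf
    hP'inf hshaW hQW hcD hcD' hq₀ hq₁ hstep0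

/-- **O5 (t′) END, cited form, X3E-CERTIFICATE CURRENCY (reverse kind).** As `…_cited_iso` with the
companion relation supplied by ONE ROW of the cell's X3E table (`translinks` X3E; columns `W, G, kind,
l, m, u`): per-pair DECIDABLE data `l m u : ℚ`, `u ≠ 0` and the two polynomial identities
`−𝔇(l,m)/(4Δ′) = u⁴·c₄(G)`, `−𝔠₆(l,m)/(8Δ′²) = u⁶·c₆(G)`, `Δ′ = c₄(W)³ − c₆(W)²` (dual Hesse
pencil = the anti-symplectic `3`-congruences; `norm_num` against `Fisher2012.eval_hesseD3 /
eval_hesseC6three`), consumed by the tree's UNCONDITIONAL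
`Fisher2012.threeCongruent_of_dualHesseCertificate_unconditional`. [cite: KrizLi2019, Thm. 1.16, Rem. 1.17 (FMS 7 (2019) e15)]
[cite: Fisher2012Hessian, §13 (analogue of Thm. 13.2 for X_E^-(3))] -/
theorem o5_index_unit_of_ordinary_companion_cited_x3eRev
    (hKL : KrizLi2019.thm116_padicLogHeegner_congruence)
    (hPT : ∀ (K : Type) [Field K] [NumberField K], poitouTate_selmerStructure_duality K)
    (hEP : ∀ (K : Type) [Field K] [NumberField K] (v : HeightOneSpectrum (𝓞 K)),
      localEulerPoincareCharacteristic (v.adicCompletion K))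
    (hYZ : YanZhu2026.thm415_padicValRat_bsd_rank_le_one)
    (hW20 : Wuthrich2014.lemma20_surjective_threeAdic_of_semistable)
    (hmod : exists_isNewformOf) (hGZK : rank_eq_analyticRank_of_analyticRank_le_one)
    (W G : WeierstrassCurve ℚ) [W.IsElliptic] [W.IsGloballyMinimal] [G.IsElliptic] [G.IsGloballyMinimal]
    (l m u : ℚ) (hu : u ≠ 0)
    (h4 : -MvPolynomial.eval ![l, m] (hesseD3 W.c₄ W.c₆) / (4 * (W.c₄ ^ 3 - W.c₆ ^ 2)) = u ^ 4 * G.c₄)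
    (h6 : -MvPolynomial.eval ![l, m] (hesseC6three W.c₄ W.c₆) / (8 * (W.c₄ ^ 3 - W.c₆ ^ 2) ^ 2) =
      u ^ 6 * G.c₆)
    (hρ : W.HasSurjectiveModNGaloisRep 3) (hadd : Addv W 3) (ht3 : NoLocalThreeTorsionAt W 3)
    (htℓ : ∀ (ℓ : ℕ) [Fact ℓ.Prime], ℓ ≠ 3 → (ℓ : ℤ) ∣ W.conductorNorm ℤ * G.conductorNorm ℤ →
      NoLocalThreeTorsionAt W ℓ)
    (hunitW : ∀ ℓ ∈ klSet W G, ℓ ≠ 3 → padicValInt 3 (nsCount W ℓ) = 0)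
    (hunitG : ∀ ℓ ∈ klSet G W, ℓ ≠ 3 → padicValInt 3 (nsCount G ℓ) = 0)
    (htam : ¬ 3 ∣ W.tamagawaProduct) (htamG : ¬ 3 ∣ G.tamagawaProduct) (hordG : GoodOrd G 3)
    (Gd : WeierstrassCurve ℚ) [Gd.IsElliptic] [Gd.IsGloballyMinimal]
    {N N' : ℕ} [NeZero N] [NeZero N'] (D : ModularParametrizationData W N)
    (D' : ModularParametrizationData G N')
    (K : Type) [Field K] [NumberField K] (hK : IsImaginaryQuadratic K)
    (hH : SatisfiesHeegnerHypothesis N K) (hH' : SatisfiesHeegnerHypothesis N' K)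
    (hKoW : kolyvagin N W K) (hKoG : kolyvagin N' G K) (hGZG : gross_zagier N' G K)
    (hd : NumberField.discr K < -4) (h3d : ¬ ((3 : ℤ) ∣ NumberField.discr K))
    (hGd : ∃ C : VariableChange ℚ, C • G.quadraticTwist (NumberField.discr K : ℚ) = Gd)
    (H : HeegnerDatum N (NumberField.discr K)) (H' : HeegnerDatum N' (NumberField.discr K))
    (ι : K →+* ℂ) (𝔭 : HeightOneSpectrum (𝓞 K)) (h𝔭 : ((3 : ℕ) : 𝓞 K) ∈ 𝔭.asIdeal)
    (he : 𝔭.asIdeal.ramificationIdx (𝓞 ℚ) = 1) (hf : 𝔭.asIdeal.inertiaDeg (𝓞 ℚ) = 1)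
    (P : (W.baseChange K).toAffine.Point) (P' : (G.baseChange K).toAffine.Point)
    (hP : WeierstrassCurve.Affine.Point.map ι.toRatAlgHom P = heegnerPointComplex D H)
    (hP' : WeierstrassCurve.Affine.Point.map ι.toRatAlgHom P' = heegnerPointComplex D' H')
    (hPinf : ¬ IsOfFinAddOrder P) (hP'inf : ¬ IsOfFinAddOrder P')
    (hshaW : Nat.card (AddCommGroup.primaryComponent (W.baseChange K).sha 3) = 1)
    (hQW : ∃ Q : (W.baseChange K).toAffine.Point, ¬ IsOfFinAddOrder Q ∧
      X11b.padicLogOrd W 3 (embAt K 3 𝔭 h𝔭 he hf) Q = 0)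
    (hcD : padicValInt 3 D.maninConstant = 0) (hcD' : padicValInt 3 D'.maninConstant = 0)
    {q₀ q₁ : ℚ} (hq₀ : shaAn G = (q₀ : ℂ)) (hq₁ : shaAn Gd = (q₁ : ℂ))
    (hstep0 : padicValRat 3 q₀ + padicValRat 3 q₁ + ((2 * padicValNat 3 G.tamagawaProduct : ℕ) : ℤ) +
        ((2 * padicValInt 3 D'.maninConstant : ℕ) : ℤ) =
      ((2 * padicValNat 3 (AddSubgroup.zmultiples P').index : ℕ) : ℤ)) :
    padicValNat 3 (AddSubgroup.zmultiples P).index = 0 :=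
  o5_index_unit_of_ordinary_companion_cited_iso hKL hPT hEP hYZ hW20 hmod hGZK W G
    (threeCongruent_of_dualHesseCertificate_unconditional W G l m u hu h4 h6) hρ hadd ht3 htℓ hunitW hunitG
    htam htamG hordG Gd D D' K hK hH hH' hKoW hKoG hGZG hd h3d hGd H H' ι 𝔭 h𝔭 he hf P P' hP hP' hPinf
    hP'inf hshaW hQW hcD hcD' hq₀ hq₁ hstep0

/-- **O5 (t′) END, cited form, KRAUS–OESTERLÉ CURRENCY.** As `…_cited_iso` with the companion relation
supplied by the FINITE trace list `hlist` of Kraus–Oesterlé's Proposition 4 (what a CONG-v1 link extended to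
the bound `6ℓ < ψ(M)` is), CONDITIONAL on ONE more registered fact, A30
`hKO : KrausOesterle1992.prop4_torsionIso_of_congruences`; irreducibility of `ρ̄_{W,3}` comes from the
END's own `hρ`. [cite: KrizLi2019, Thm. 1.16, Rem. 1.17 (FMS 7 (2019) e15)] [cite: KrausOesterle1992, Prop. 4 (pp. 263–264)] -/
theorem o5_index_unit_of_ordinary_companion_cited_ko
    (hKO : KrausOesterle1992.prop4_torsionIso_of_congruences)
    (hKL : KrizLi2019.thm116_padicLogHeegner_congruence)
    (hPT : ∀ (K : Type) [Field K] [NumberField K], poitouTate_selmerStructure_duality K)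
    (hEP : ∀ (K : Type) [Field K] [NumberField K] (v : HeightOneSpectrum (𝓞 K)),
      localEulerPoincareCharacteristic (v.adicCompletion K))
    (hYZ : YanZhu2026.thm415_padicValRat_bsd_rank_le_one)
    (hW20 : Wuthrich2014.lemma20_surjective_threeAdic_of_semistable)
    (hmod : exists_isNewformOf) (hGZK : rank_eq_analyticRank_of_analyticRank_le_one)
    (W G : WeierstrassCurve ℚ) [W.IsElliptic] [W.IsGloballyMinimal] [G.IsElliptic] [G.IsGloballyMinimal]
    (hlist : ∀ (ℓ : ℕ) [Fact ℓ.Prime],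
      6 * ℓ < KrausOesterle1992.gammaZeroIndex (KrausOesterle1992.modulus W G) →
        (padicValNat ℓ (W.conductorNorm ℤ * G.conductorNorm ℤ) = 0 →
            (3 : ℤ) ∣ W.frobeniusTrace ℓ - G.frobeniusTrace ℓ) ∧
          (padicValNat ℓ (W.conductorNorm ℤ * G.conductorNorm ℤ) = 1 →
            (3 : ℤ) ∣ W.frobeniusTrace ℓ * G.frobeniusTrace ℓ - (ℓ + 1)))
    (hρ : W.HasSurjectiveModNGaloisRep 3) (hadd : Addv W 3) (ht3 : NoLocalThreeTorsionAt W 3)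
    (htℓ : ∀ (ℓ : ℕ) [Fact ℓ.Prime], ℓ ≠ 3 → (ℓ : ℤ) ∣ W.conductorNorm ℤ * G.conductorNorm ℤ →
      NoLocalThreeTorsionAt W ℓ)
    (hunitW : ∀ ℓ ∈ klSet W G, ℓ ≠ 3 → padicValInt 3 (nsCount W ℓ) = 0)
    (hunitG : ∀ ℓ ∈ klSet G W, ℓ ≠ 3 → padicValInt 3 (nsCount G ℓ) = 0)
    (htam : ¬ 3 ∣ W.tamagawaProduct) (htamG : ¬ 3 ∣ G.tamagawaProduct) (hordG : GoodOrd G 3)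
    (Gd : WeierstrassCurve ℚ) [Gd.IsElliptic] [Gd.IsGloballyMinimal]
    {N N' : ℕ} [NeZero N] [NeZero N'] (D : ModularParametrizationData W N)
    (D' : ModularParametrizationData G N')
    (K : Type) [Field K] [NumberField K] (hK : IsImaginaryQuadratic K)
    (hH : SatisfiesHeegnerHypothesis N K) (hH' : SatisfiesHeegnerHypothesis N' K)
    (hKoW : kolyvagin N W K) (hKoG : kolyvagin N' G K) (hGZG : gross_zagier N' G K)
    (hd : NumberField.discr K < -4) (h3d : ¬ ((3 : ℤ) ∣ NumberField.discr K))
    (hGd : ∃ C : VariableChange ℚ, C • G.quadraticTwist (NumberField.discr K : ℚ) = Gd)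
    (H : HeegnerDatum N (NumberField.discr K)) (H' : HeegnerDatum N' (NumberField.discr K))
    (ι : K →+* ℂ) (𝔭 : HeightOneSpectrum (𝓞 K)) (h𝔭 : ((3 : ℕ) : 𝓞 K) ∈ 𝔭.asIdeal)
    (he : 𝔭.asIdeal.ramificationIdx (𝓞 ℚ) = 1) (hf : 𝔭.asIdeal.inertiaDeg (𝓞 ℚ) = 1)
    (P : (W.baseChange K).toAffine.Point) (P' : (G.baseChange K).toAffine.Point)
    (hP : WeierstrassCurve.Affine.Point.map ι.toRatAlgHom P = heegnerPointComplex D H)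
    (hP' : WeierstrassCurve.Affine.Point.map ι.toRatAlgHom P' = heegnerPointComplex D' H')
    (hPinf : ¬ IsOfFinAddOrder P) (hP'inf : ¬ IsOfFinAddOrder P')
    (hshaW : Nat.card (AddCommGroup.primaryComponent (W.baseChange K).sha 3) = 1)
    (hQW : ∃ Q : (W.baseChange K).toAffine.Point, ¬ IsOfFinAddOrder Q ∧
      X11b.padicLogOrd W 3 (embAt K 3 𝔭 h𝔭 he hf) Q = 0)
    (hcD : padicValInt 3 D.maninConstant = 0) (hcD' : padicValInt 3 D'.maninConstant = 0)
    {q₀ q₁ : ℚ} (hq₀ : shaAn G = (q₀ : ℂ)) (hq₁ : shaAn Gd = (q₁ : ℂ))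
    (hstep0 : padicValRat 3 q₀ + padicValRat 3 q₁ + ((2 * padicValNat 3 G.tamagawaProduct : ℕ) : ℤ) +
        ((2 * padicValInt 3 D'.maninConstant : ℕ) : ℤ) =
      ((2 * padicValNat 3 (AddSubgroup.zmultiples P').index : ℕ) : ℤ)) :
    padicValNat 3 (AddSubgroup.zmultiples P).index = 0 :=
  o5_index_unit_of_ordinary_companion_cited hKL hPT hEP hYZ hW20 hmod hGZK W G
    (isCongruentModThree_of_prop4 W G hKO hρ hlist) hρ hadd ht3 htℓ hunitW hunitG htam
    htamG hordG Gd D D' K hK hH hH' hKoW hKoG hGZG hd h3d hGd H H' ι 𝔭 h𝔭 he hf P P' hP hP' hPinf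
    hP'inf hshaW hQW hcD hcD' hq₀ hq₁ hstep0

end End


end Summit.BirchSwinnertonDyer.Rank1Residual.O5.HeegnerLogTransport

end
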